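import Summits.BirchSwinnertonDyer.BirchSwinnertonDyer.Theorems.PrintCf2RubinValueTwoKatzMeasureJZeroSeamPerUnitFamily
import HarnessLib

/-!
# The per-unit `hX` AND `hΦ` of the `j = 0` seam for a FAMILY of units with ONE constant `A = φ_F(a)^{k+1}` — the Frobenius-image twin
# (de Shalit II §4.5 (iv), §4.9 (ii), §4.10 (26), §4.14 (38) assembled — proofs only)

Cell `bsd-print-cf2`, width seat `bsd-line-cf2-p1-w2` g25 (piece (γ)-FAM); `--supports` the print leaf stmt-BirchSwinnertonDyer-24720
(helper, Theses-free).  THEOREMS ONLY; no `def`, no named fact, no `sorry`.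

`PrintCf2RubinValueTwoKatzMeasureJZeroSeamPerUnitFamily.exists_unit_forall_map_relCoatesWiles_eq_of_divisionPoints` ((β)-FAM) gives, for de
Shalit's SHARED division points and a family of units presented by algebraic theta `t`-expansions, ONE Tate unit `a` with
`ρ(c_{β j,k}) = φ_F(a)^{k+1}·ι⁻¹(−12·(#S_j·E_{k+1}(Ω, L) − E_{k+1}(Ω, L′_j)))` for all `j, k` (the seam's `hX` with one `A`).  The seam
(`KatzMeasureJZeroSeam.twist_mul_integral_eq_of_perUnit`) also consumes the FROBENIUS IMAGES `φ(c_{β j,k})` (`hΦ`) with the SAME `A`.  Here: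

* ★★★ `exists_unit_forall_map_relCoatesWiles_and_frob_eq_of_divisionPoints` — (β)-FAM's hypotheses PLUS the `φ`-direction semiconjugation
  of the reading (`τ′ : R → R` with `φ ∘ ψ_𝔓 = ψ_𝔓 ∘ τ′`, `W_R^{τ′} = W_R`, `τ′ K_j = K_j`, `τ′` permutes the `x j c`; on the canonical reading
  `τ′ = σ_v|_R`, `DeShalit1987.readingFrob`, `frobUnitBall_comp_readingHom`) and the complex reading of the CONJUGATE base point
  `(τ′x₀, τ′y₀) = ξ(Ω′)` (`Ω′ = ψ(v)·Ω` by II.1.5 (vii) at `𝔞 = 𝔭`), `Ω′ ∉ L′_j`: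
  **`∃ a ∈ 𝒪_Fˣ, ∀ j k, ρ(c_{β j,k}) = φ_F(a)^{k+1}·ι⁻¹(−12·(#S_j·E_{k+1}(Ω, L) − E_{k+1}(Ω, L′_j))) ∧`
  `ρ(φ(c_{β j,k})) = φ_F(a)^{k+1}·ι⁻¹(−12·(#S_j·E_{k+1}(Ω′, L) − E_{k+1}(Ω′, L′_j)))`** — ONE `a` from brick B10a
  (`exists_unit_forall_ptOfZ_hom_hom_cohPt_eq`), then per unit: (hβ) by `relColemanSeries_eq_subst_subst_of_semiconj`, `hX` by (β)′
  `map_relCoatesWiles_eq_of_bridge_series`, the conjugate presentation `G_j^φ = ψ_𝔓(Q_R(τ′x₀, τ′y₀; x j; K_j))` by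
  `iterate_map_thetaTExpansion_of_semiconj` (`Φ := φ`, one step), `hΦ` by (γ)′ `map_frob_relCoatesWiles_eq_of_bridge_series`.

The conversion of the `hΦ` value to the seam's shape `ψ̂·(N𝔟·E(𝔭) − E(𝔭𝔟))` (`Ω′ = ψ(𝔭)Ω`, homogeneity `PeriodPair.eisensteinE_mulLeft`,
`ψ(𝔭)⁻¹·𝔟⁻¹L = (𝔭𝔟)⁻¹L`) is the packager's step and is NOT done here.
HONEST FRAMING: an assembly of accepted kernel theorems; the shared/per-unit hypotheses are named, not discharged; nothing closes a crux;
no summit statement is proved; BSD is not proved by any of this.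

## References
* [deShalit1987] E. de Shalit, *Iwasawa theory of elliptic curves with complex multiplication* (1987), II §4.4 (iv), (12) (p. 57), II §4.5 (iv)
  (p. 57), II §4.9 (i)(ii) (p. 62–63), II §4.10 (26) (p. 64), II §4.14 (38) (p. 71).
-/

-- the summit namespace `Summit.BirchSwinnertonDyer.BirchSwinnertonDyer` repeats the problem name by design (D-0017)
set_option linter.dupNamespace false
set_option autoImplicit false

noncomputable section

open scoped Classical
open PowerSeries IsDedekindDomain NumberField ValuativeRel Field PeriodPair
open Literature.NumberTheory.NumberFields Literature.NumberTheory.EllipticCurves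
open Literature.NumberTheory.GaloisRepresentations Literature.NumberTheory.GaloisRepresentations.IsNonarchimedeanLocalField
  Literature.NumberTheory.GaloisRepresentations.LubinTate Literature.NumberTheory.EllipticCurves.FormalGroupChart

namespace Summit.BirchSwinnertonDyer.BirchSwinnertonDyer.Theorems.PrintCf2.KatzMeasureJZeroSeam

attribute [local instance] ltNormUniformSpace ltNormIsUniformAddGroup rk1 nF nE fintypeResidueField

variable (K : Type) [Field K] [NumberField K] (v : HeightOneSpectrum (𝓞 K)) [v.asIdeal.LiesOver (ratPlace 2).asIdeal]
  (he : v.asIdeal.ramificationIdx (𝓞 ℚ) = 1) (hf : v.asIdeal.inertiaDeg (𝓞 ℚ) = 1)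

set_option maxHeartbeats 1600000 in
/-- ★★★ **`hX` and `hΦ` for a FAMILY of units with ONE constant `A = φ_F(a)^{k+1}`** (de Shalit II §4.4 (iv) + §4.9 (ii) + §4.10 (26) for every
unit of the class sum and for its Frobenius conjugate, assembled): under the hypotheses of
`exists_unit_forall_map_relCoatesWiles_eq_of_divisionPoints` plus the `φ`-direction semiconjugation `τ′` of the reading and the complex
reading `(τ′x₀, τ′y₀) = ξ(Ω′)` of the conjugate base point,
**`∃ a ∈ 𝒪_Fˣ, ∀ j k, ρ(c_{β j,k}) = φ_F(a)^{k+1}·ι⁻¹(−12·(#(S j)·E_{k+1}(Ω, L) − E_{k+1}(Ω, L′ j))) ∧`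
`ρ(φ(c_{β j,k})) = φ_F(a)^{k+1}·ι⁻¹(−12·(#(S j)·E_{k+1}(Ω′, L) − E_{k+1}(Ω′, L′ j)))`**.
[cite: deShalit1987, II §4.4 (iv), (12) (p. 57), II §4.5 (iv) (p. 57), II §4.9 Proposition (ii) (p. 63), II §4.10 (26) (p. 64), II §4.14 (38) (p. 71)] -/
theorem exists_unit_forall_map_relCoatesWiles_and_frob_eq_of_divisionPoints
    (hq : residueFieldCard (v.adicCompletion K) = 2)
    (h2 : (valuation (v.adicCompletion K)).IsUniformizer ((((2 : ℕ) : 𝒪[v.adicCompletion K]) : v.adicCompletion K)))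
    (u : 𝒪[v.adicCompletion K]ˣ)
    (E : IntermediateField (v.adicCompletion K) (AlgebraicClosure (v.adicCompletion K)))
    [FiniteDimensional (v.adicCompletion K) E] [Normal (v.adicCompletion K) E] [IsGalois (v.adicCompletion K) E]
    (hE : E ≤ maxUnramified (v.adicCompletion K))
    {σ₀ : absoluteGaloisGroup (v.adicCompletion K)} (hσ₀ : IsAbsArithFrob σ₀)
    (ρ : unitBall E →+* ℂ_[2]) (φF : v.adicCompletion K →+* ℂ_[2])
    (hρ : ρ.comp (algebraMap (LTCoeff (v.adicCompletion K)) (unitBall E)) =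
      φF.comp ((algebraMap 𝒪[v.adicCompletion K] (v.adicCompletion K)).comp (LTCoeff.of (v.adicCompletion K)).symm.toRingHom))
    (ιp : PadicAlgCl 2 ≃+* ℂ)
    -- the `ℤ₂`-datum of the curve with its Lubin–Tate structure (`cm7Padic_exists_formalGroupLaw_eq_ltF`): `P ↦ exp_V(c·log_V)`, `V̂ = F_P`, `2 = ϖc`
    (V : WeierstrassCurve ℤ_[2]) {c ϖ : ℤ_[2]} {P : PowerSeries ℤ_[2]}
    (hP : P.map PadicInt.Coe.ringHom =
      (V.map PadicInt.Coe.ringHom).formalExp.subst (C (c : ℚ_[2]) * (V.map PadicInt.Coe.ringHom).formalLog))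
    (hA : IsLTRing c 2) (hPlt : IsLTSeries c 2 P) (hVlt : V.formalGroupLaw = ltF hA hPlt) (hp : ((2 : ℕ) : ℤ_[2]) = ϖ * c) (hϖ : IsUnit ϖ)
    (heπ : ((integerEquivAdicCompletionIntegers v).trans (padicIntEquivOfDegreeOne K 2 v he hf))
      ((u : 𝒪[v.adicCompletion K]) * ((2 : ℕ) : 𝒪[v.adicCompletion K])) = c)
    [hEll : ∀ m : ℕ, (curveOver (E ⊔ ltField ((u : 𝒪[v.adicCompletion K]) * ((2 : ℕ) : 𝒪[v.adicCompletion K])) m :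
        IntermediateField (v.adicCompletion K) (AlgebraicClosure (v.adicCompletion K)))
      (V.map ((LTCoeff.of (v.adicCompletion K)).toRingHom.comp
        ((integerEquivAdicCompletionIntegers v).trans (padicIntEquivOfDegreeOne K 2 v he hf)).symm.toRingHom))).IsElliptic]
    -- shared: the `𝔓`-adic reading of the theta data, the model, the semiconjugating endomorphism, the base point, the complex reading
    {R : Type*} [CommRing R] (ψ𝔓 : R →+* unitBall E) (WR : WeierstrassCurve R)
    (hWR : WR.map ψ𝔓 = (V.map ((LTCoeff.of (v.adicCompletion K)).toRingHom.comp
        ((integerEquivAdicCompletionIntegers v).trans (padicIntEquivOfDegreeOne K 2 v he hf)).symm.toRingHom)).map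
      (algebraMap (LTCoeff (v.adicCompletion K)) (unitBall E)))
    (τ : R →+* R) (hτ : ((frobUnitBall E σ₀).symm : unitBall E →+* unitBall E).comp ψ𝔓 = ψ𝔓.comp τ)
    (hWτ : WR.map τ = WR) (x₀ y₀ : R) (φC : R →+* ℂ) (WC : WeierstrassCurve ℂ) (L : PeriodPair) (Ω : ℂ)
    (hg₂ : L.g₂ = WC.c₄ / 12) (hg₃ : L.g₃ = WC.c₆ / 216) (hV : WR.map φC = WC)
    (ha : φC x₀ = ℘[L] Ω - WC.b₂ / 12) (hb : φC y₀ = (℘'[L] Ω - WC.a₁ * (℘[L] Ω - WC.b₂ / 12) - WC.a₃) / 2)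
    (hQθ : ρ.comp ψ𝔓 = ((algebraMap (PadicAlgCl 2) ℂ_[2]).comp ιp.symm.toRingHom).comp φC)
    (hW : (WR.map φC).map ((algebraMap (PadicAlgCl 2) ℂ_[2]).comp ιp.symm.toRingHom) =
      (V.map (((padicEquivOfDegreeOne K 2 v he hf).symm.toRingHom).comp (PadicInt.Coe.ringHom (p := 2)))).map φF)
    -- shared: de Shalit's division points on the lane curve, levelwise, with the chart identity at `τ^{m+1}(x₀, y₀)`
    (U : ∀ m : ℕ, (curveOver (E ⊔ ltField ((u : 𝒪[v.adicCompletion K]) * ((2 : ℕ) : 𝒪[v.adicCompletion K])) m :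
        IntermediateField (v.adicCompletion K) (AlgebraicClosure (v.adicCompletion K)))
      (V.map ((LTCoeff.of (v.adicCompletion K)).toRingHom.comp
        ((integerEquivAdicCompletionIntegers v).trans (padicIntEquivOfDegreeOne K 2 v he hf)).symm.toRingHom))).toAffine.Point)
    (hU : ∀ m : ℕ, U m ∈ kernel (NormedField.valuation
        (K := (E ⊔ ltField ((u : 𝒪[v.adicCompletion K]) * ((2 : ℕ) : 𝒪[v.adicCompletion K])) m :
          IntermediateField (v.adicCompletion K) (AlgebraicClosure (v.adicCompletion K)))))
      (curveOver (E ⊔ ltField ((u : 𝒪[v.adicCompletion K]) * ((2 : ℕ) : 𝒪[v.adicCompletion K])) m :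
          IntermediateField (v.adicCompletion K) (AlgebraicClosure (v.adicCompletion K)))
        (V.map ((LTCoeff.of (v.adicCompletion K)).toRingHom.comp
          ((integerEquivAdicCompletionIntegers v).trans (padicIntEquivOfDegreeOne K 2 v he hf)).symm.toRingHom))))
    (hord : ∀ m : ℕ, addOrderOf (U m) = 2 ^ (m + 1))
    (hcoh : ∀ m : ℕ, ltSMul (maxNilIdeal (v.adicCompletion K)
          (E ⊔ ltField ((u : 𝒪[v.adicCompletion K]) * ((2 : ℕ) : 𝒪[v.adicCompletion K])) (m + 1) :
            IntermediateField (v.adicCompletion K) (AlgebraicClosure (v.adicCompletion K))))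
        (isLTRing_LTCoeff (isUniformizer_unit_mul h2 u))
        (isLTSeries_map_LTCoeff_of_degree_one ((integerEquivAdicCompletionIntegers v).trans (padicIntEquivOfDegreeOne K 2 v he hf))
          hq heπ hPlt)
        (LTCoeff.of (v.adicCompletion K) ((u : 𝒪[v.adicCompletion K]) * ((2 : ℕ) : 𝒪[v.adicCompletion K])))
        (zPt (U (m + 1)) (hU (m + 1))) =
      inclPt (sup_le_sup_left (ltField_mono (isUniformizer_unit_mul h2 u) (Nat.le_succ m)) E) (zPt (U m) (hU m)))
    (xR yR : (m : ℕ) → ↥(E ⊔ ltField ((u : 𝒪[v.adicCompletion K]) * ((2 : ℕ) : 𝒪[v.adicCompletion K])) m :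
      IntermediateField (v.adicCompletion K) (AlgebraicClosure (v.adicCompletion K))))
    (h₀ : ∀ m : ℕ, (curveOver (E ⊔ ltField ((u : 𝒪[v.adicCompletion K]) * ((2 : ℕ) : 𝒪[v.adicCompletion K])) m :
          IntermediateField (v.adicCompletion K) (AlgebraicClosure (v.adicCompletion K)))
        (V.map ((LTCoeff.of (v.adicCompletion K)).toRingHom.comp
          ((integerEquivAdicCompletionIntegers v).trans (padicIntEquivOfDegreeOne K 2 v he hf)).symm.toRingHom))).toAffine.Nonsingular
      (((inclUnitBall (F := v.adicCompletion K) (le_sup_left : E ≤ E ⊔ ltField _ m) (ψ𝔓 (τ^[m + 1] x₀)) :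
        unitBall (E ⊔ ltField ((u : 𝒪[v.adicCompletion K]) * ((2 : ℕ) : 𝒪[v.adicCompletion K])) m :
          IntermediateField (v.adicCompletion K) (AlgebraicClosure (v.adicCompletion K)))) :
        (E ⊔ ltField ((u : 𝒪[v.adicCompletion K]) * ((2 : ℕ) : 𝒪[v.adicCompletion K])) m : IntermediateField (v.adicCompletion K) _)))
      (((inclUnitBall (F := v.adicCompletion K) (le_sup_left : E ≤ E ⊔ ltField _ m) (ψ𝔓 (τ^[m + 1] y₀)) :
        unitBall (E ⊔ ltField ((u : 𝒪[v.adicCompletion K]) * ((2 : ℕ) : 𝒪[v.adicCompletion K])) m :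
          IntermediateField (v.adicCompletion K) (AlgebraicClosure (v.adicCompletion K)))) :
        (E ⊔ ltField ((u : 𝒪[v.adicCompletion K]) * ((2 : ℕ) : 𝒪[v.adicCompletion K])) m : IntermediateField (v.adicCompletion K) _))))
    (hR : ∀ m : ℕ, (curveOver (E ⊔ ltField ((u : 𝒪[v.adicCompletion K]) * ((2 : ℕ) : 𝒪[v.adicCompletion K])) m :
          IntermediateField (v.adicCompletion K) (AlgebraicClosure (v.adicCompletion K)))
        (V.map ((LTCoeff.of (v.adicCompletion K)).toRingHom.comp
          ((integerEquivAdicCompletionIntegers v).trans (padicIntEquivOfDegreeOne K 2 v he hf)).symm.toRingHom))).toAffine.Nonsingular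
      (xR m) (yR m))
    (hpt : ∀ m : ℕ, (.some _ _ (h₀ m) : (curveOver (E ⊔ ltField ((u : 𝒪[v.adicCompletion K]) * ((2 : ℕ) : 𝒪[v.adicCompletion K])) m :
          IntermediateField (v.adicCompletion K) (AlgebraicClosure (v.adicCompletion K)))
        (V.map ((LTCoeff.of (v.adicCompletion K)).toRingHom.comp
          ((integerEquivAdicCompletionIntegers v).trans (padicIntEquivOfDegreeOne K 2 v he hf)).symm.toRingHom))).toAffine.Point) -
      U m = .some _ _ (hR m))
    -- per unit `j`: the unit, its presentation (complex data `L′ j ⊇ L` with representatives `S j`), its `τ`-symmetry, its values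
    {J : Type*} (β : J → RelNormCoherentUnits (isUniformizer_unit_mul h2 u) E) (G : J → PowerSeries (unitBall E))
    (L' : J → PeriodPair) (S : J → Finset ℂ) (hS : ∀ j, L.IsLatticeReps (L' j) (S j)) (hΩ : ∀ j, Ω ∉ (L' j).lattice)
    (Kc : J → R) (x : J → ℂ → R) (uc : J → ℂ → Rˣ)
    (hK : ∀ j, φC (Kc j) = L.deltaRatio (L' j) * (L.g₂ ^ 3 - 27 * L.g₃ ^ 2) ^ ((S j).card - 1))
    (hx : ∀ j, ∀ c ∈ (S j).erase 0, φC (x j c) = ℘[L] c - WC.b₂ / 12) (hu : ∀ j, ∀ c ∈ (S j).erase 0, (uc j c : R) = x₀ - x j c)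
    (hG : ∀ j, G j = PowerSeries.map ψ𝔓 (C (Kc j) * ∏ c ∈ (S j).erase 0,
        PowerSeries.invOfUnit ((WR.translateX x₀ y₀).subst WR.formalNeg - C (x j c)) (uc j c) ^ 6))
    (hKτ : ∀ j, τ (Kc j) = Kc j) (eι : J → ℂ → ℂ) (heT : ∀ j, ∀ c ∈ (S j).erase 0, eι j c ∈ (S j).erase 0)
    (hinj : ∀ j, Set.InjOn (eι j) ((S j).erase 0)) (hsurj : ∀ j, Set.SurjOn (eι j) ((S j).erase 0) ((S j).erase 0))
    (hxτ : ∀ j, ∀ c ∈ (S j).erase 0, τ (x j c) = x j (eι j c))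
    (hval : ∀ (j : J) (m : ℕ), ((inclUnitBall (F := v.adicCompletion K) (le_sup_left : E ≤ E ⊔ ltField _ m) (ψ𝔓 (Kc j)) :
        unitBall (E ⊔ ltField ((u : 𝒪[v.adicCompletion K]) * ((2 : ℕ) : 𝒪[v.adicCompletion K])) m :
          IntermediateField (v.adicCompletion K) (AlgebraicClosure (v.adicCompletion K)))) :
        (E ⊔ ltField ((u : 𝒪[v.adicCompletion K]) * ((2 : ℕ) : 𝒪[v.adicCompletion K])) m : IntermediateField (v.adicCompletion K) _)) *
        ∏ c ∈ (S j).erase 0, ((xR m - (((inclUnitBall (F := v.adicCompletion K) (le_sup_left : E ≤ E ⊔ ltField _ m) (ψ𝔓 (x j c)) :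
          unitBall (E ⊔ ltField ((u : 𝒪[v.adicCompletion K]) * ((2 : ℕ) : 𝒪[v.adicCompletion K])) m :
            IntermediateField (v.adicCompletion K) (AlgebraicClosure (v.adicCompletion K)))) :
          (E ⊔ ltField ((u : 𝒪[v.adicCompletion K]) * ((2 : ℕ) : 𝒪[v.adicCompletion K])) m : IntermediateField (v.adicCompletion K) _))))⁻¹) ^ 6 =
      (((β j).val m : unitBall (E ⊔ ltField ((u : 𝒪[v.adicCompletion K]) * ((2 : ℕ) : 𝒪[v.adicCompletion K])) m :
          IntermediateField (v.adicCompletion K) (AlgebraicClosure (v.adicCompletion K)))) :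
        (E ⊔ ltField ((u : 𝒪[v.adicCompletion K]) * ((2 : ℕ) : 𝒪[v.adicCompletion K])) m : IntermediateField (v.adicCompletion K) _)))
    -- the `φ`-direction semiconjugation of the reading (`τ′ = σ_v|_R`) and the conjugate base point `(τ′x₀, τ′y₀) = ξ(Ω′)`
    (τ' : R →+* R) (hτ' : (frobUnitBall E σ₀ : unitBall E →+* unitBall E).comp ψ𝔓 = ψ𝔓.comp τ') (hWτ' : WR.map τ' = WR)
    (hKτ' : ∀ j, τ' (Kc j) = Kc j) (eι' : J → ℂ → ℂ) (heT' : ∀ j, ∀ c ∈ (S j).erase 0, eι' j c ∈ (S j).erase 0)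
    (hinj' : ∀ j, Set.InjOn (eι' j) ((S j).erase 0)) (hsurj' : ∀ j, Set.SurjOn (eι' j) ((S j).erase 0) ((S j).erase 0))
    (hxτ' : ∀ j, ∀ c ∈ (S j).erase 0, τ' (x j c) = x j (eι' j c))
    (Ω' : ℂ) (hΩ' : ∀ j, Ω' ∉ (L' j).lattice)
    (ha' : φC (τ' x₀) = ℘[L] Ω' - WC.b₂ / 12) (hb' : φC (τ' y₀) = (℘'[L] Ω' - WC.a₁ * (℘[L] Ω' - WC.b₂ / 12) - WC.a₃) / 2) :
    ∃ a : 𝒪[v.adicCompletion K]ˣ, ∀ (j : J) (k : ℕ),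
      (ρ (PowerSeries.constantCoeff ((fun g : PowerSeries (unitBall E) =>
          (invDiff (isLTRing_LTCoeff (isUniformizer_unit_mul h2 u))
              (isLTSeries_LTCoeff ((u : 𝒪[v.adicCompletion K]) * ((2 : ℕ) : 𝒪[v.adicCompletion K])))).map
              (algebraMap (LTCoeff (v.adicCompletion K)) (unitBall E)) *
            PowerSeries.derivative (unitBall E) g)^[k] (relLogDerivSeries (isUniformizer_unit_mul h2 u) E hq hE hσ₀ (β j)))) =
        (φF ((a : 𝒪[v.adicCompletion K]) : v.adicCompletion K)) ^ (k + 1) *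
          ((ιp.symm (-12 * (((S j).card : ℂ) * L.eisensteinE (k + 1) Ω - (L' j).eisensteinE (k + 1) Ω)) : PadicAlgCl 2) : ℂ_[2])) ∧
      ρ ((frobUnitBall E σ₀ : unitBall E →+* unitBall E) (PowerSeries.constantCoeff ((fun g : PowerSeries (unitBall E) =>
          (invDiff (isLTRing_LTCoeff (isUniformizer_unit_mul h2 u))
              (isLTSeries_LTCoeff ((u : 𝒪[v.adicCompletion K]) * ((2 : ℕ) : 𝒪[v.adicCompletion K])))).map
              (algebraMap (LTCoeff (v.adicCompletion K)) (unitBall E)) *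
            PowerSeries.derivative (unitBall E) g)^[k] (relLogDerivSeries (isUniformizer_unit_mul h2 u) E hq hE hσ₀ (β j))))) =
        (φF ((a : 𝒪[v.adicCompletion K]) : v.adicCompletion K)) ^ (k + 1) *
          ((ιp.symm (-12 * (((S j).card : ℂ) * L.eisensteinE (k + 1) Ω' - (L' j).eisensteinE (k + 1) Ω')) : PadicAlgCl 2) : ℂ_[2]) := by
  -- ONE Tate unit from the shared torsion points (B10a)
  obtain ⟨a, ha'0⟩ := exists_unit_forall_ptOfZ_hom_hom_cohPt_eq
    ((integerEquivAdicCompletionIntegers v).trans (padicIntEquivOfDegreeOne K 2 v he hf)) hq (isUniformizer_unit_mul h2 u) heπ hA hPlt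
    hVlt hp hϖ E U hU hord hcoh
  -- the parameter `t_m = h([a]_f ω_{m+1})` is non-zero: `P(t_m) = U_m` has order `2^{m+1} ≠ 1`
  have ht0 : ∀ m : ℕ, (((evalPt₁ (maxNilIdeal (v.adicCompletion K)
      (E ⊔ ltField ((u : 𝒪[v.adicCompletion K]) * ((2 : ℕ) : 𝒪[v.adicCompletion K])) m :
        IntermediateField (v.adicCompletion K) (AlgebraicClosure (v.adicCompletion K))))
      (hom (isLTRing_LTCoeff (isUniformizer_unit_mul h2 u))
        (isLTSeries_map_LTCoeff_of_degree_one ((integerEquivAdicCompletionIntegers v).trans (padicIntEquivOfDegreeOne K 2 v he hf))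
          hq heπ hPlt) (isLTSeries_LTCoeff _) 1) (constantCoeff_hom _ _ _ 1)
      (evalPt₁ (maxNilIdeal (v.adicCompletion K)
        (E ⊔ ltField ((u : 𝒪[v.adicCompletion K]) * ((2 : ℕ) : 𝒪[v.adicCompletion K])) m :
          IntermediateField (v.adicCompletion K) (AlgebraicClosure (v.adicCompletion K))))
        (hom (isLTRing_LTCoeff (isUniformizer_unit_mul h2 u)) (isLTSeries_LTCoeff _) (isLTSeries_LTCoeff _)
          (LTCoeff.of (v.adicCompletion K) (a : 𝒪[v.adicCompletion K]))) (constantCoeff_hom _ _ _ _)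
        (inclPt (le_sup_right : ltField _ m ≤ E ⊔ ltField _ m) (cohPt (isUniformizer_unit_mul h2 u) m))) :
      (maxNilIdeal (v.adicCompletion K) (E ⊔ ltField ((u : 𝒪[v.adicCompletion K]) * ((2 : ℕ) : 𝒪[v.adicCompletion K])) m :
        IntermediateField (v.adicCompletion K) (AlgebraicClosure (v.adicCompletion K)))).toIdeal) :
      unitBall (E ⊔ ltField ((u : 𝒪[v.adicCompletion K]) * ((2 : ℕ) : 𝒪[v.adicCompletion K])) m :
        IntermediateField (v.adicCompletion K) (AlgebraicClosure (v.adicCompletion K)))) :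
      (E ⊔ ltField ((u : 𝒪[v.adicCompletion K]) * ((2 : ℕ) : 𝒪[v.adicCompletion K])) m :
        IntermediateField (v.adicCompletion K) (AlgebraicClosure (v.adicCompletion K)))) ≠ 0 := by
    intro m h0
    have h1 : U m = 0 := by rw [← ha'0 m, ptOfZ_of_eq_zero h0]
    have h3 := hord m
    rw [h1, addOrderOf_zero] at h3
    exact absurd h3.symm (ne_of_gt (one_lt_pow₀ one_lt_two (Nat.succ_ne_zero m)))
  refine ⟨a, fun j k => ?_⟩
  -- per unit: V1+V2 with that `a` gives (hβ)
  have hβ := relColemanSeries_eq_subst_subst_of_semiconj (isUniformizer_unit_mul h2 u) E hq hE hσ₀ (β j) (G j)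
    (constantCoeff_hom _ _ _ 1) (constantCoeff_hom _ _ _ _) _ (fun m => hEll m) ψ𝔓 WR hWR ((S j).erase 0) (Kc j) x₀ y₀ (x j) (uc j)
    (hu j) (hG j) τ hτ hWτ (hKτ j) (eι j) (heT j) (hinj j) (hsurj j) (hxτ j) ht0 xR yR h₀ hR (fun m _ => by rw [ha'0 m]; exact hpt m)
    (hval j)
  refine ⟨?_, ?_⟩
  · -- `hX` by (β)′
    have h := map_relCoatesWiles_eq_of_bridge_series K v he hf hq h2 u E hE hσ₀ (β j) k ρ φF hρ ιp V hP heπ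
      (isLTSeries_map_LTCoeff_of_degree_one ((integerEquivAdicCompletionIntegers v).trans (padicIntEquivOfDegreeOne K 2 v he hf))
        hq heπ hPlt) (LTCoeff.of (v.adicCompletion K) (a : 𝒪[v.adicCompletion K])) (G j) hβ WR x₀ y₀ (x j) (uc j) (Kc j) φC WC L
      (hS j) hg₂ hg₃ (hΩ j) hV ha hb (hK j) (hx j) (hu j) ψ𝔓 (hG j) hQθ hW
    rwa [RingEquiv.symm_apply_apply] at h
  · -- the conjugate presentation `G_j^φ = ψ_𝔓(Q_R(τ′x₀, τ′y₀; x j; K_j))` (one `φ`-step of the semiconjugation), then `hΦ` by (γ)′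
    obtain ⟨uc', huc', hGφ⟩ := iterate_map_thetaTExpansion_of_semiconj WR x₀ y₀ ψ𝔓 (frobUnitBall E σ₀ : unitBall E →+* unitBall E) τ'
      ((S j).erase 0) (x j) (uc j) (Kc j) (eι' j) hτ' hWτ' (hKτ' j) (hu j) (heT' j) (hinj' j) (hsurj' j) (hxτ' j) 1
    simp only [Function.iterate_one] at huc' hGφ
    rw [← hG j] at hGφ
    have h := map_frob_relCoatesWiles_eq_of_bridge_series K v he hf hq h2 u E hE hσ₀ (β j) k ρ φF hρ ιp V hP heπ
      (isLTSeries_map_LTCoeff_of_degree_one ((integerEquivAdicCompletionIntegers v).trans (padicIntEquivOfDegreeOne K 2 v he hf))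
        hq heπ hPlt) (LTCoeff.of (v.adicCompletion K) (a : 𝒪[v.adicCompletion K])) (G j) hβ WR (τ' x₀) (τ' y₀) (x j) uc' (Kc j) φC WC L
      (hS j) hg₂ hg₃ (hΩ' j) hV ha' hb' (hK j) (hx j) huc' ψ𝔓 hGφ hQθ hW
    rwa [RingEquiv.symm_apply_apply] at h

end Summit.BirchSwinnertonDyer.BirchSwinnertonDyer.Theorems.PrintCf2.KatzMeasureJZeroSeam

end
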